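import Summits.KontsevichZagierPeriods.Zeta5Search.TwoTaleP15SecondTaleB

/-!
# The two-tale point P15: Lemma 8 for `B_k` — part 2 (zones β₁ and γ)

HONEST FRAMING: systematic search; no irrationality claim unless certified.

Cell pub-zeta5, T3 service [Zudilin2014ZetaTwo, Section 6, eq. (T3a)].  At the partner of P15:
* **zone β₁** (`15n+1 ≤ k ≤ 16n`): `B_k = numT′(−k)/dhatT(−k)` (the doubled block vanishes simply at `−k`),
  `‖B_k‖_p ≤ p^{1−E(k)}` for `26n < p²` (`padicNorm_coefBT_zoneB1`; one-digit Legendre valuations, the negative floor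
  `⌊(2k−â₀)/p⌋ = −⌊(â₀−1−2k)/p⌋ − 1`);
* **zone γ** (`24n+2 ≤ k ≤ 26n+1`): `B_k = numT(−k)/dhatT(−k)` (simple pole), `‖B_k‖_p ≤ p^{1−E(k)}`
  (`padicNorm_coefBT_zoneG`; `⌊(b̂₂−1−k)/p⌋ = −⌊(k−b̂₂)/p⌋ − 1`).
-/

noncomputable section

namespace Summit.KontsevichZagierPeriods.Zeta5Search.TwoTaleP15

open Finset Polynomial
open Literature.NumberTheory.Irrationality.Zudilin2014
open Literature.NumberTheory.DiophantineApproximation (RhinViola.padicValNat_factorial_of_lt_sq)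
open Literature.NumberTheory.Transcendental (OddZeta.dvd_lcmUpto)
section ZoneB1

variable {n : ℕ} {p : ℕ} [hp : Fact p.Prime]

/-- Norm of `(−1)^e · a! · b!` (`a, b < p²`): `p^{−⌊a/p⌋−⌊b/p⌋}`. -/
theorem padicNorm_sign_fac_fac {e a b : ℕ} (ha : a < p ^ 2) (hb : b < p ^ 2) :
    padicNorm p ((-1 : ℚ) ^ e * ((a.factorial : ℕ) : ℚ) * ((b.factorial : ℕ) : ℚ))
      = (p : ℚ) ^ (-((a / p : ℕ) : ℤ) - ((b / p : ℕ) : ℤ)) := by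
  have hp0 : (p : ℚ) ≠ 0 := by exact_mod_cast hp.out.ne_zero
  have hs : padicNorm p ((-1 : ℚ) ^ e) = 1 := by
    rcases neg_one_pow_eq_or ℚ e with h | h <;> rw [h] <;> simp
  rw [padicNorm.mul, padicNorm.mul, hs, one_mul, padicNorm_factorial ha, padicNorm_factorial hb, ← zpow_add₀ hp0]
  congr 1

/-- Norm of `(−1)^e · m! · binom(M, m)` (`m < p²`): at most `p^{−⌊m/p⌋ − digit}`. -/
theorem padicNorm_sign_fac_choose_le {e m M : ℕ} (hm : m < p ^ 2) (hmM : m ≤ M) :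
    padicNorm p ((-1 : ℚ) ^ e * ((m.factorial : ℕ) : ℚ) * ((Nat.choose M m : ℕ) : ℚ))
      ≤ (p : ℚ) ^ (-((m / p : ℕ) : ℤ) - ((M / p - m / p - (M - m) / p : ℕ) : ℤ)) := by
  have hp0 : (p : ℚ) ≠ 0 := by exact_mod_cast hp.out.ne_zero
  have hs : padicNorm p ((-1 : ℚ) ^ e) = 1 := by
    rcases neg_one_pow_eq_or ℚ e with h | h <;> rw [h] <;> simp
  rw [padicNorm.mul, padicNorm.mul, hs, one_mul, padicNorm_factorial hm, sub_eq_add_neg, zpow_add₀ hp0]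
  exact mul_le_mul_of_nonneg_left (padicNorm_choose_le hmM) (by positivity)

/-- **Zone β₁** (`15n+1 ≤ k ≤ 16n`, `26n < p²`): `‖B_k‖_p ≤ p^{1−E(k)}` — here `B_k = numT′(−k)/dhatT(−k)` with the
doubled block vanishing simply at `−k`. -/
theorem padicNorm_coefBT_zoneB1 (hp2 : 26 * n < p ^ 2) {k : ℤ} (h1 : 15 * (n : ℤ) + 1 ≤ k)
    (h2 : k ≤ 16 * (n : ℤ)) :
    padicNorm p (coefBT (aT n) (bT n) k) ≤ (p : ℚ) ^ (1 - EZ p n k) := by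
  have hp0 : (p : ℚ) ≠ 0 := by exact_mod_cast hp.out.ne_zero
  have hp1 : (1 : ℚ) ≤ p := by exact_mod_cast hp.out.one_lt.le
  have hppos : 0 < p := hp.out.pos
  have hD2 : k ∈ Ico (aT n 2) (bT n 2) := by simp [mem_Ico]; omega
  have hD3 : k ∈ Ico (aT n 3) (bT n 3) := by simp [mem_Ico]; omega
  have hB0 : 2 * k ∈ Ico (bT n 0) (aT n 0) := by simp [mem_Ico]; omega
  have hm : multT (aT n) (bT n) k = 2 := (multT_partner k).2.1 h1 (by omega)
  have h0 : (numT (aT n) (bT n)).eval (-(k : ℚ)) = 0 := eval_numT_partner_eq_zero (by omega) (by omega)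
  -- the explicit value
  have eP0 : ∏ l ∈ (Ico (bT n 0) (aT n 0)).erase (2 * k), ((l : ℚ) - 2 * k)
      = (-1) ^ (2 * k - bT n 0).toNat * (((2 * k - bT n 0).toNat.factorial : ℕ) : ℚ)
        * (((aT n 0 - 1 - 2 * k).toNat.factorial : ℕ) : ℚ) := by
    rw [← prod_erase_sub_eq hB0]; exact prod_congr rfl fun l _ => by push_cast; ring
  have eP1 : ∏ i ∈ Ico (bT n 1) (aT n 1), ((i : ℚ) - k)
      = (-1) ^ (aT n 1 - bT n 1).toNat * (((aT n 1 - bT n 1).toNat.factorial : ℕ) : ℚ)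
        * ((Nat.choose (k - bT n 1).toNat (aT n 1 - bT n 1).toNat : ℕ) : ℚ) :=
    prod_Ico_sub_eq _ _ _ (by simp; omega) (by simp; omega)
  rw [coefBT_of_double_root hm h0, eval_derivative_numT_root hB0, eval_dhatT_of_double hD2 hD3, eP0, eP1]
  -- sizes for one-digit Legendre
  have t0 : (2 * k - bT n 0).toNat < p ^ 2 := by simp; omega
  have t0' : (aT n 0 - 1 - 2 * k).toNat < p ^ 2 := by simp; omega
  have t1 : (aT n 1 - bT n 1).toNat < p ^ 2 := by simp; omega
  have t2 : (k - aT n 2).toNat < p ^ 2 := by simp; omega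
  have t2' : (bT n 2 - 1 - k).toNat < p ^ 2 := by simp; omega
  have t3 : (k - aT n 3).toNat < p ^ 2 := by simp; omega
  have t3' : (bT n 3 - 1 - k).toNat < p ^ 2 := by simp; omega
  -- norms of the pieces (before naming them)
  have nP0 := padicNorm_sign_fac_fac (p := p) (e := (2 * k - bT n 0).toNat) t0 t0'
  have nD2 := padicNorm_sign_fac_fac (p := p) (e := (k - aT n 2).toNat) t2 t2'
  have nD3 := padicNorm_sign_fac_fac (p := p) (e := (k - aT n 3).toNat) t3 t3'
  have nP1 := padicNorm_sign_fac_choose_le (p := p) (e := (aT n 1 - bT n 1).toNat) t1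
    (show (aT n 1 - bT n 1).toNat ≤ (k - bT n 1).toNat by simp; omega)
  -- name the pieces (opaque)
  generalize hP0 : ((-1 : ℚ) ^ (2 * k - bT n 0).toNat * (((2 * k - bT n 0).toNat.factorial : ℕ) : ℚ)
        * (((aT n 0 - 1 - 2 * k).toNat.factorial : ℕ) : ℚ)) = P0 at nP0 ⊢
  generalize hP1 : ((-1 : ℚ) ^ (aT n 1 - bT n 1).toNat * (((aT n 1 - bT n 1).toNat.factorial : ℕ) : ℚ)
        * ((Nat.choose (k - bT n 1).toNat (aT n 1 - bT n 1).toNat : ℕ) : ℚ)) = P1 at nP1 ⊢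
  generalize hD2' : ((-1 : ℚ) ^ (k - aT n 2).toNat * (((k - aT n 2).toNat.factorial : ℕ) : ℚ)
        * (((bT n 2 - 1 - k).toNat.factorial : ℕ) : ℚ)) = D2 at nD2 ⊢
  generalize hD3' : ((-1 : ℚ) ^ (k - aT n 3).toNat * (((k - aT n 3).toNat.factorial : ℕ) : ℚ)
        * (((bT n 3 - 1 - k).toNat.factorial : ℕ) : ℚ)) = D3 at nD3 ⊢
  have n2 : padicNorm p (2 : ℚ) ≤ 1 := by have := padicNorm.of_int (p := p) 2; simpa using this
  rw [padicNorm.div, padicNorm.mul, padicNorm.mul, padicNorm.mul, padicNorm.mul, padicNorm_normT_partner hp2,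
    nP0, nD2, nD3]
  -- abbreviations for the exponents
  set a11 : ℤ := ((11 * n / p : ℕ) : ℤ)
  set a17 : ℤ := ((17 * n / p : ℕ) : ℤ)
  set a5 : ℤ := ((5 * n / p : ℕ) : ℤ)
  set bu : ℤ := (((2 * k - bT n 0).toNat / p : ℕ) : ℤ)
  set bw : ℤ := (((aT n 0 - 1 - 2 * k).toNat / p : ℕ) : ℤ)
  set c5 : ℤ := (((aT n 1 - bT n 1).toNat / p : ℕ) : ℤ)
  set cd : ℤ := (((k - bT n 1).toNat / p - (aT n 1 - bT n 1).toNat / p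
      - ((k - bT n 1).toNat - (aT n 1 - bT n 1).toNat) / p : ℕ) : ℤ)
  set d2 : ℤ := (((k - aT n 2).toNat / p : ℕ) : ℤ)
  set d2' : ℤ := (((bT n 2 - 1 - k).toNat / p : ℕ) : ℤ)
  set d3 : ℤ := (((k - aT n 3).toNat / p : ℕ) : ℤ)
  set d3' : ℤ := (((bT n 3 - 1 - k).toNat / p : ℕ) : ℤ)
  have hApos : (0 : ℚ) < (p : ℚ) ^ (-(a11 + a11 - a17 - a5)) := by positivity
  have hBpos : (0 : ℚ) ≤ (p : ℚ) ^ (-bu - bw) := by positivity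
  have hB : padicNorm p 2 * (p : ℚ) ^ (-bu - bw) ≤ (p : ℚ) ^ (-bu - bw) := by
    nlinarith [padicNorm.nonneg (p := p) 2]
  have step1 : (p : ℚ) ^ (-(a11 + a11 - a17 - a5)) * (padicNorm p 2 * (p : ℚ) ^ (-bu - bw)) * padicNorm p P1
      / ((p : ℚ) ^ (-d2 - d2') * (p : ℚ) ^ (-d3 - d3'))
      ≤ (p : ℚ) ^ (-(a11 + a11 - a17 - a5)) * (p : ℚ) ^ (-bu - bw) * (p : ℚ) ^ (-c5 - cd)
        / ((p : ℚ) ^ (-d2 - d2') * (p : ℚ) ^ (-d3 - d3')) := by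
    apply div_le_div_of_nonneg_right _ (by positivity)
    exact mul_le_mul (mul_le_mul_of_nonneg_left hB hApos.le) nP1 (padicNorm.nonneg _) (by positivity)
  refine step1.trans ?_
  rw [← zpow_add₀ hp0, ← zpow_add₀ hp0, ← zpow_add₀ hp0, ← zpow_sub₀ hp0]
  refine zpow_le_zpow_right₀ hp1 ?_
  -- the exponent inequality (an identity): express everything by integer floors
  have cast : ∀ X : ℤ, 0 ≤ X → ((X.toNat / p : ℕ) : ℤ) = X / (p : ℤ) := fun X hX => by
    rw [Int.natCast_ediv, Int.toNat_of_nonneg hX]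
  have castN : ∀ m : ℕ, ((m / p : ℕ) : ℤ) = (m : ℤ) / (p : ℤ) := fun m => Int.natCast_ediv m p
  have cC : cd = (((k - bT n 1).toNat / p : ℕ) : ℤ) - c5 - ((((k - bT n 1).toNat - (aT n 1 - bT n 1).toNat) / p : ℕ) : ℤ) := by
    have e : (k - bT n 1).toNat = (aT n 1 - bT n 1).toNat + ((k - bT n 1).toNat - (aT n 1 - bT n 1).toNat) := by
      simp only [aT_one, bT_one]; omega
    have subC : (aT n 1 - bT n 1).toNat / p + ((k - bT n 1).toNat - (aT n 1 - bT n 1).toNat) / p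
        ≤ (k - bT n 1).toNat / p := by
      conv_rhs => rw [e]
      exact Nat.add_div_le_add_div _ _ _
    simp only [cd, c5]; omega
  have eKa : ((k - bT n 1).toNat - (aT n 1 - bT n 1).toNat) = (k - aT n 1).toNat := by
    simp only [aT_one, bT_one]; omega
  have x11 : a11 = (11 * (n : ℤ)) / (p : ℤ) := by simp only [a11, castN]; push_cast; rfl
  have x17 : a17 = (17 * (n : ℤ)) / (p : ℤ) := by simp only [a17, castN]; push_cast; rfl
  have x5 : a5 = (5 * (n : ℤ)) / (p : ℤ) := by simp only [a5, castN]; push_cast; rfl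
  have xbu : bu = (2 * k - (15 * n + 2)) / (p : ℤ) := by
    simp only [bu]; rw [cast _ (by simp only [bT_zero]; omega)]; simp only [bT_zero]
  have xbw : bw = (32 * (n : ℤ) + 1 - 2 * k) / (p : ℤ) := by
    simp only [bw]; rw [cast _ (by simp only [aT_zero]; omega)]; simp only [aT_zero]; ring_nf
  have xc5 : c5 = (5 * (n : ℤ)) / (p : ℤ) := by
    simp only [c5]; rw [cast _ (by simp only [aT_one, bT_one]; omega)]; simp only [aT_one, bT_one]; ring_nf
  have xkb : (((k - bT n 1).toNat / p : ℕ) : ℤ) = (k - (6 * n + 1)) / (p : ℤ) := by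
    rw [cast _ (by simp only [bT_one]; omega)]; simp only [bT_one]
  have xka : (((k - aT n 1).toNat / p : ℕ) : ℤ) = (k - (11 * n + 1)) / (p : ℤ) := by
    rw [cast _ (by simp only [aT_one]; omega)]; simp only [aT_one]
  have xd2 : d2 = (k - (13 * n + 1)) / (p : ℤ) := by
    simp only [d2]; rw [cast _ (by simp only [aT_two]; omega)]; simp only [aT_two]
  have xd2' : d2' = (24 * (n : ℤ) + 1 - k) / (p : ℤ) := by
    simp only [d2']; rw [cast _ (by simp only [bT_two]; omega)]; simp only [bT_two]; ring_nf
  have xd3 : d3 = (k - (15 * n + 1)) / (p : ℤ) := by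
    simp only [d3]; rw [cast _ (by simp only [aT_three]; omega)]; simp only [aT_three]
  have xd3' : d3' = (26 * (n : ℤ) + 1 - k) / (p : ℤ) := by
    simp only [d3']; rw [cast _ (by simp only [bT_three]; omega)]; simp only [bT_three]; ring_nf
  -- the one negative floor
  have hneg : (2 * k - (32 * (n : ℤ) + 2)) / (p : ℤ) = -((32 * (n : ℤ) + 1 - 2 * k) / (p : ℤ)) - 1 := by
    rw [← neg_succ_ediv _ hppos]; congr 1; ring
  rw [cC, eKa, xkb, xka]
  unfold EZ
  rw [hneg, ← x11, ← x17, ← xbu, ← xbw, ← xd2, ← xd2', ← xd3, ← xd3']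
  have e6 : (k - (6 * (n : ℤ) + 1)) / (p : ℤ) - (k - (11 * n + 1)) / (p : ℤ) - (5 * (n : ℤ)) / (p : ℤ)
      = (k - (6 * (n : ℤ) + 1)) / (p : ℤ) - c5 - (k - (11 * n + 1)) / (p : ℤ) := by rw [xc5]; ring
  rw [e6]
  linarith

end ZoneB1

section ZoneG

variable {n : ℕ} {p : ℕ} [hp : Fact p.Prime]

/-- Norm of `(−1)^e · m! · binom(K, m)` for `K < p²`: exactly `p^{−⌊K/p⌋ + ⌊(K−m)/p⌋}` (`m!·binom(K,m) = K!/(K−m)!`). -/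
theorem padicNorm_sign_fac_choose_eq {e m K : ℕ} (hK : K < p ^ 2) (hmK : m ≤ K) :
    padicNorm p ((-1 : ℚ) ^ e * ((m.factorial : ℕ) : ℚ) * ((Nat.choose K m : ℕ) : ℚ))
      = (p : ℚ) ^ (-((K / p : ℕ) : ℤ) + (((K - m) / p : ℕ) : ℤ)) := by
  have hp0 : (p : ℚ) ≠ 0 := by exact_mod_cast hp.out.ne_zero
  have hs : padicNorm p ((-1 : ℚ) ^ e) = 1 := by
    rcases neg_one_pow_eq_or ℚ e with h | h <;> rw [h] <;> simp
  have hf : ((m.factorial : ℕ) : ℚ) * ((Nat.choose K m : ℕ) : ℚ)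
      = ((K.factorial : ℕ) : ℚ) / (((K - m).factorial : ℕ) : ℚ) := by
    rw [eq_div_iff (by positivity)]
    have := Nat.choose_mul_factorial_mul_factorial hmK
    have h' : ((Nat.choose K m : ℕ) : ℚ) * (m.factorial : ℕ) * ((K - m).factorial : ℕ) = (K.factorial : ℕ) := by
      exact_mod_cast this
    linear_combination h'
  rw [mul_assoc, padicNorm.mul, hs, one_mul, hf, padicNorm.div, padicNorm_factorial hK,
    padicNorm_factorial (lt_of_le_of_lt (Nat.sub_le _ _) hK), ← zpow_sub₀ hp0]
  congr 1; ring

/-- **Zone γ** (`24n+2 ≤ k ≤ 26n+1`, `26n < p²`): `‖B_k‖_p ≤ p^{1−E(k)}` — here `B_k = numT(−k)/dhatT(−k)` (a simple pole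
of the denominator). -/
theorem padicNorm_coefBT_zoneG (hp2 : 26 * n < p ^ 2) {k : ℤ} (h1 : 24 * (n : ℤ) + 2 ≤ k)
    (h2 : k ≤ 26 * (n : ℤ) + 1) :
    padicNorm p (coefBT (aT n) (bT n) k) ≤ (p : ℚ) ^ (1 - EZ p n k) := by
  have hp0 : (p : ℚ) ≠ 0 := by exact_mod_cast hp.out.ne_zero
  have hp1 : (1 : ℚ) ≤ p := by exact_mod_cast hp.out.one_lt.le
  have hppos : 0 < p := hp.out.pos
  have hD3 : k ∈ Ico (aT n 3) (bT n 3) := by simp [mem_Ico]; omega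
  have hnD2 : k ∉ Ico (aT n 2) (bT n 2) := by simp [mem_Ico]; omega
  have hm : multT (aT n) (bT n) k = 1 := (multT_partner k).2.2 h1 h2
  -- the explicit value
  have eP0 : ∏ l ∈ Ico (bT n 0) (aT n 0), ((l : ℚ) - ((2 * k : ℤ) : ℚ))
      = (-1) ^ (aT n 0 - bT n 0).toNat * (((aT n 0 - bT n 0).toNat.factorial : ℕ) : ℚ)
        * ((Nat.choose (2 * k - bT n 0).toNat (aT n 0 - bT n 0).toNat : ℕ) : ℚ) :=
    prod_Ico_sub_eq _ _ _ (by simp; omega) (by simp; omega)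
  have eP1 : ∏ i ∈ Ico (bT n 1) (aT n 1), ((i : ℚ) - k)
      = (-1) ^ (aT n 1 - bT n 1).toNat * (((aT n 1 - bT n 1).toNat.factorial : ℕ) : ℚ)
        * ((Nat.choose (k - bT n 1).toNat (aT n 1 - bT n 1).toNat : ℕ) : ℚ) :=
    prod_Ico_sub_eq _ _ _ (by simp; omega) (by simp; omega)
  have eD : (dhatT (aT n) (bT n) k).eval (-(k : ℚ))
      = ((-1) ^ (bT n 2 - aT n 2).toNat * (((bT n 2 - aT n 2).toNat.factorial : ℕ) : ℚ)
          * ((Nat.choose (k - aT n 2).toNat (bT n 2 - aT n 2).toNat : ℕ) : ℚ))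
        * ((-1) ^ (k - aT n 3).toNat * (((k - aT n 3).toNat.factorial : ℕ) : ℚ)
          * (((bT n 3 - 1 - k).toNat.factorial : ℕ) : ℚ)) := by
    unfold dhatT
    rw [erase_eq_of_notMem hnD2, eval_mul, eval_prod, eval_prod]
    have e : ∀ (s : Finset ℤ), ∏ i ∈ s, ((X + C (i : ℚ)).eval (-(k : ℚ))) = ∏ i ∈ s, ((i : ℚ) - k) := fun s =>
      prod_congr rfl fun i _ => by simp; ring
    rw [e, e, prod_Ico_sub_eq _ _ _ (by simp; omega) (by simp; omega), prod_erase_sub_eq hD3]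
  rw [coefBT_of_simple hm, eval_numT_partner, eP0, eP1, eD]
  -- sizes
  have t0 : (aT n 0 - bT n 0).toNat < p ^ 2 := by simp; omega
  have t1 : (aT n 1 - bT n 1).toNat < p ^ 2 := by simp; omega
  have t2 : (k - aT n 2).toNat < p ^ 2 := by simp; omega
  have t3 : (k - aT n 3).toNat < p ^ 2 := by simp; omega
  have t3' : (bT n 3 - 1 - k).toNat < p ^ 2 := by simp; omega
  -- norms
  have nP0 := padicNorm_sign_fac_choose_le (p := p) (e := (aT n 0 - bT n 0).toNat) t0
    (show (aT n 0 - bT n 0).toNat ≤ (2 * k - bT n 0).toNat by simp; omega)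
  have nP1 := padicNorm_sign_fac_choose_le (p := p) (e := (aT n 1 - bT n 1).toNat) t1
    (show (aT n 1 - bT n 1).toNat ≤ (k - bT n 1).toNat by simp; omega)
  have nD2 := padicNorm_sign_fac_choose_eq (p := p) (e := (bT n 2 - aT n 2).toNat) t2
    (show (bT n 2 - aT n 2).toNat ≤ (k - aT n 2).toNat by simp; omega)
  have nD3 := padicNorm_sign_fac_fac (p := p) (e := (k - aT n 3).toNat) t3 t3'
  generalize hP0 : ((-1 : ℚ) ^ (aT n 0 - bT n 0).toNat * (((aT n 0 - bT n 0).toNat.factorial : ℕ) : ℚ)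
        * ((Nat.choose (2 * k - bT n 0).toNat (aT n 0 - bT n 0).toNat : ℕ) : ℚ)) = P0 at nP0 ⊢
  generalize hP1 : ((-1 : ℚ) ^ (aT n 1 - bT n 1).toNat * (((aT n 1 - bT n 1).toNat.factorial : ℕ) : ℚ)
        * ((Nat.choose (k - bT n 1).toNat (aT n 1 - bT n 1).toNat : ℕ) : ℚ)) = P1 at nP1 ⊢
  generalize hD2' : ((-1 : ℚ) ^ (bT n 2 - aT n 2).toNat * (((bT n 2 - aT n 2).toNat.factorial : ℕ) : ℚ)
          * ((Nat.choose (k - aT n 2).toNat (bT n 2 - aT n 2).toNat : ℕ) : ℚ)) = D2 at nD2 ⊢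
  generalize hD3' : ((-1 : ℚ) ^ (k - aT n 3).toNat * (((k - aT n 3).toNat.factorial : ℕ) : ℚ)
          * (((bT n 3 - 1 - k).toNat.factorial : ℕ) : ℚ)) = D3 at nD3 ⊢
  rw [padicNorm.div, padicNorm.mul, padicNorm.mul, padicNorm.mul, padicNorm_normT_partner hp2, nD2, nD3]
  set a11 : ℤ := ((11 * n / p : ℕ) : ℤ)
  set a17 : ℤ := ((17 * n / p : ℕ) : ℤ)
  set a5 : ℤ := ((5 * n / p : ℕ) : ℤ)
  set b17 : ℤ := (((aT n 0 - bT n 0).toNat / p : ℕ) : ℤ)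
  set bd : ℤ := (((2 * k - bT n 0).toNat / p - (aT n 0 - bT n 0).toNat / p
      - ((2 * k - bT n 0).toNat - (aT n 0 - bT n 0).toNat) / p : ℕ) : ℤ)
  set c5 : ℤ := (((aT n 1 - bT n 1).toNat / p : ℕ) : ℤ)
  set cd : ℤ := (((k - bT n 1).toNat / p - (aT n 1 - bT n 1).toNat / p
      - ((k - bT n 1).toNat - (aT n 1 - bT n 1).toNat) / p : ℕ) : ℤ)
  set d2 : ℤ := (((k - aT n 2).toNat / p : ℕ) : ℤ)
  set d2' : ℤ := ((((k - aT n 2).toNat - (bT n 2 - aT n 2).toNat) / p : ℕ) : ℤ)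
  set d3 : ℤ := (((k - aT n 3).toNat / p : ℕ) : ℤ)
  set d3' : ℤ := (((bT n 3 - 1 - k).toNat / p : ℕ) : ℤ)
  have hApos : (0 : ℚ) < (p : ℚ) ^ (-(a11 + a11 - a17 - a5)) := by positivity
  have step1 : (p : ℚ) ^ (-(a11 + a11 - a17 - a5)) * padicNorm p P0 * padicNorm p P1
      / ((p : ℚ) ^ (-d2 + d2') * (p : ℚ) ^ (-d3 - d3'))
      ≤ (p : ℚ) ^ (-(a11 + a11 - a17 - a5)) * (p : ℚ) ^ (-b17 - bd) * (p : ℚ) ^ (-c5 - cd)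
        / ((p : ℚ) ^ (-d2 + d2') * (p : ℚ) ^ (-d3 - d3')) := by
    apply div_le_div_of_nonneg_right _ (by positivity)
    exact mul_le_mul (mul_le_mul_of_nonneg_left nP0 hApos.le) nP1 (padicNorm.nonneg _) (by positivity)
  refine step1.trans ?_
  rw [← zpow_add₀ hp0, ← zpow_add₀ hp0, ← zpow_add₀ hp0, ← zpow_sub₀ hp0]
  refine zpow_le_zpow_right₀ hp1 ?_
  -- exponents
  have cast : ∀ X : ℤ, 0 ≤ X → ((X.toNat / p : ℕ) : ℤ) = X / (p : ℤ) := fun X hX => by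
    rw [Int.natCast_ediv, Int.toNat_of_nonneg hX]
  have castN : ∀ m : ℕ, ((m / p : ℕ) : ℤ) = (m : ℤ) / (p : ℤ) := fun m => Int.natCast_ediv m p
  have cB : bd = (((2 * k - bT n 0).toNat / p : ℕ) : ℤ) - b17
      - ((((2 * k - bT n 0).toNat - (aT n 0 - bT n 0).toNat) / p : ℕ) : ℤ) := by
    have e : (2 * k - bT n 0).toNat = (aT n 0 - bT n 0).toNat + ((2 * k - bT n 0).toNat - (aT n 0 - bT n 0).toNat) := by
      simp only [aT_zero, bT_zero]; omega
    have subC : (aT n 0 - bT n 0).toNat / p + ((2 * k - bT n 0).toNat - (aT n 0 - bT n 0).toNat) / p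
        ≤ (2 * k - bT n 0).toNat / p := by
      conv_rhs => rw [e]
      exact Nat.add_div_le_add_div _ _ _
    simp only [bd, b17]; omega
  have cC : cd = (((k - bT n 1).toNat / p : ℕ) : ℤ) - c5
      - ((((k - bT n 1).toNat - (aT n 1 - bT n 1).toNat) / p : ℕ) : ℤ) := by
    have e : (k - bT n 1).toNat = (aT n 1 - bT n 1).toNat + ((k - bT n 1).toNat - (aT n 1 - bT n 1).toNat) := by
      simp only [aT_one, bT_one]; omega
    have subC : (aT n 1 - bT n 1).toNat / p + ((k - bT n 1).toNat - (aT n 1 - bT n 1).toNat) / p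
        ≤ (k - bT n 1).toNat / p := by
      conv_rhs => rw [e]
      exact Nat.add_div_le_add_div _ _ _
    simp only [cd, c5]; omega
  have eKa0 : ((2 * k - bT n 0).toNat - (aT n 0 - bT n 0).toNat) = (2 * k - aT n 0).toNat := by
    simp only [aT_zero, bT_zero]; omega
  have eKa : ((k - bT n 1).toNat - (aT n 1 - bT n 1).toNat) = (k - aT n 1).toNat := by
    simp only [aT_one, bT_one]; omega
  have eKb : ((k - aT n 2).toNat - (bT n 2 - aT n 2).toNat) = (k - bT n 2).toNat := by
    simp only [aT_two, bT_two]; omega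
  have x11 : a11 = (11 * (n : ℤ)) / (p : ℤ) := by simp only [a11, castN]; push_cast; rfl
  have x17 : a17 = (17 * (n : ℤ)) / (p : ℤ) := by simp only [a17, castN]; push_cast; rfl
  have x5 : a5 = (5 * (n : ℤ)) / (p : ℤ) := by simp only [a5, castN]; push_cast; rfl
  have xb17 : b17 = (17 * (n : ℤ)) / (p : ℤ) := by
    simp only [b17]; rw [cast _ (by simp only [aT_zero, bT_zero]; omega)]; simp only [aT_zero, bT_zero]; ring_nf
  have xc5 : c5 = (5 * (n : ℤ)) / (p : ℤ) := by
    simp only [c5]; rw [cast _ (by simp only [aT_one, bT_one]; omega)]; simp only [aT_one, bT_one]; ring_nf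
  have xkb0 : (((2 * k - bT n 0).toNat / p : ℕ) : ℤ) = (2 * k - (15 * n + 2)) / (p : ℤ) := by
    rw [cast _ (by simp only [bT_zero]; omega)]; simp only [bT_zero]
  have xka0 : (((2 * k - aT n 0).toNat / p : ℕ) : ℤ) = (2 * k - (32 * n + 2)) / (p : ℤ) := by
    rw [cast _ (by simp only [aT_zero]; omega)]; simp only [aT_zero]
  have xkb : (((k - bT n 1).toNat / p : ℕ) : ℤ) = (k - (6 * n + 1)) / (p : ℤ) := by
    rw [cast _ (by simp only [bT_one]; omega)]; simp only [bT_one]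
  have xka : (((k - aT n 1).toNat / p : ℕ) : ℤ) = (k - (11 * n + 1)) / (p : ℤ) := by
    rw [cast _ (by simp only [aT_one]; omega)]; simp only [aT_one]
  have xd2 : d2 = (k - (13 * n + 1)) / (p : ℤ) := by
    simp only [d2]; rw [cast _ (by simp only [aT_two]; omega)]; simp only [aT_two]
  have xd2' : d2' = (k - (24 * (n : ℤ) + 2)) / (p : ℤ) := by
    simp only [d2']; rw [eKb, cast _ (by simp only [bT_two]; omega)]; simp only [bT_two]
  have xd3 : d3 = (k - (15 * n + 1)) / (p : ℤ) := by
    simp only [d3]; rw [cast _ (by simp only [aT_three]; omega)]; simp only [aT_three]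
  have xd3' : d3' = (26 * (n : ℤ) + 1 - k) / (p : ℤ) := by
    simp only [d3']; rw [cast _ (by simp only [bT_three]; omega)]; simp only [bT_three]; ring_nf
  -- the one negative floor: ⌊(24n+1−k)/p⌋ = −⌊(k−24n−2)/p⌋ − 1
  have hneg : (24 * (n : ℤ) + 1 - k) / (p : ℤ) = -((k - (24 * (n : ℤ) + 2)) / (p : ℤ)) - 1 := by
    rw [← neg_succ_ediv _ hppos]; congr 1; ring
  rw [cB, cC, eKa0, eKa, xkb0, xka0, xkb, xka]
  unfold EZ
  rw [hneg, ← x11, ← xd2, ← xd2', ← xd3, ← xd3']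
  rw [xb17, xc5, x17, x5] at *
  linarith

end ZoneG
end Summit.KontsevichZagierPeriods.Zeta5Search.TwoTaleP15

end
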